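import Summits.QuantumFields.YangMills.Theorems.FluctuationComparisonRegPrIntLS2BetaStageFeedersAssembly
import Summits.QuantumFields.YangMills.Theorems.FluctuationComparisonRegPrIntLS2BetaStageFlapLetterOfC4
import Summits.QuantumFields.YangMills.Theorems.FluctuationComparisonRegPrIntLS2BetaStageAxialFeedback
import HarnessLib

/-!
# S2β · the (D-stage) REL-TEL road END TO END — (D-stage)(Gx) (✓p823271∕✓p827429's `hD` with `Ax := AxStage`, any guard `Gx ⟹ arc(V e) ≤ 1∕128`) FROM
# EXACTLY {the BKG letter — or the `L = 3` Thm-1 pair `h3` — and KEYREL(Gx)}: px12 g24's displayed composition, typed ONCE by kernel over the five landed doors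

Cell `ym3-torus` (rung R3 = continuum `SU(2)` Yang–Mills on T³ — NOT d = 4, NOT infinite volume, NOT a mass gap, NOT Clay).  Width seat «width 12» `ym3-torus-px12`
(gen 25), FREE px helper on crux `stmt-QuantumFields-20520`; `--kind proof --supports … --as helper`, count-neutral, DEFINITION-FREE (0 `def`∕`instance`∕`notation`∕`sorry`).

WHAT (px12 g24 ■ FINAL 15:39Z «SUCCESSOR №2»; ★★OWNER g47 №498∕№500 (B): the (D)-side term of record).  The (D)-side of GAP♯∘ under a guard `Gx` with
`Gx ⟹ ∀ e, arc(V e) ≤ 1∕128` was left as the DISPLAYED term `dStage_of_feedbackLetter Gx (feedbackLetterPrefix_of_letters Gx hGx hKEY (flapLetter_of_C4 Gx hGx (bkgTower_of_bkgLetter Gx hBkg)))`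
over HYPOTHESIS letters `hKEY : KEYREL Gx` (px10 g24's lane: ✓p826733 ∕ 7‴ → 9‴ → 12‴ → DOOR `keyRel_of_bkgTower`, RULING №101) and `hBkg` (the background letter =
[Balaban1985Variational] Thm 1 (9) read on the fibre's argmin; a THEOREM from the Thm-1 pair: ✓`bkgLetter_of_thm1PairAtThree`, ✓`bkgLetter_of_thm1Pair`, zero-hypothesis
at `L ≥ 5` ✓`bkgLetter_body_five`).  THIS FILE types the term, so that the composition is kernel-certified in the TREE (not in a HOME cert) and consumable by ONE name:
* §1 ★★★ `dStage_of_bkgLetter_keyRel (Gx) (hGx) (hBkg) (hKEY)` : (D-stage)(Gx) — ✓p824471 ∘ ✓p827346 ∘ ✓p827374 ∘ ✓p825096, `hBkg`, `hKEY` displayed.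
* §2 ★★★ `dStage_of_three_keyRel (Gx) (hGx) (h3) (hKEY)` : (D-stage)(Gx) from the knit's own `h3` (EMBARGO-LITE №58) and KEYREL(Gx) ONLY (`hBkg := bkgLetter_of_thm1PairAtThree h3 Gx`,
  ✓p822405).  After the DOOR lands: `dStage_of_three_keyRel Gx hGx h3 (keyRel_of_bkgTower Gx hGx (bkgTower_of_bkgLetter Gx (bkgLetter_of_thm1PairAtThree h3 Gx)))` — the
  (D)-side under the small-bond guard from `h3` alone (successor's one-line §3, append protocol).
Strata instances (`Gx := G_IRR ∧ small-bond`, `G_A′ ∧ small-bond`, the knit's `hD₁`∕`hD₂` guards) are the sibling file `…StageDOfLettersStrata` (400-line budget).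

THE (D)-SIDE GAP LIST BY KERNEL (★p1 «every gap named»): the census knit ✓p827429 `uniformFibreGapOrbit_of_letters (Ax := AxStage) h3 (axStage_exists _) hD₁ hM₁ (axStage_exists _) hD₂ hM₂`
wants `hD_i` = (D-stage)(G_i) for the BARE stratum guards `G_i` (irreducible ∕ abelian datum); this lineage gives (D-stage)(G_i ∧ «∀ e, ‖logVec (su2Quat (V e))‖ ≤ 1∕128») from
{h3, KEYREL}.  The residue is EXACTLY (a) KEYREL(G_i ∧ small-bond) — px10 g24's DOOR `keyRel_of_bkgTower` (RULING №101, in flight; then (a) is gone) — and (b) the SMALL-BOND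
CLAUSE of the guard: the WLOG doors ✓p822838∕✓p824968 remove it GIVEN a gauge supplier `G_i V → ∃ u, (G_i ∧ small-bond)(u•V)`, which is FALSE as a `∀ F ∀ J` letter (toron triple
✓p826411∕✓p826915∕✓p827293, UV3-NODE §90: the Polyakov arc `π∕N_J`, `N_J = 2L^{m+J}`, is not gauged below `1∕128` when `N_J < 128π`); replacements of record (§84.8∕§90.3):
px21 g23's refined profile letters D2–D5 ((a)-kinematic), (S2) toron-like frames (§30), an `N_J`-dependent start ∕ height floor (planners).  Nothing in this file removes (b).

HONEST SCOPE.  Composition∕instantiation over landed theorems by name; `hKEY` (and `hBkg` ∕ `h3`) are HYPOTHESES; nothing of Bałaban's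
renormalisation-group analysis is asserted or proved ([Balaban1985Variational] Thm 1 (8)–(10) p.279 is the source of `hBkg`'s shape, (4) p.278 the fibre;
[Balaban1985RegularSpaces] (1.29) p.81, Lemma 1 p.79 the local axial-gauge sizes behind (L♭)); (D-ax)∕(D-stage) at the BARE strata guards, KEYREL, AVG₂♭-ax_q, GAP♯∘
(`stub_uniformFibreGapOrbit`; registry `Lines/semiclassical_s2beta.lean` 3732b7df UNTOUCHED), the five registered stubs (0∕5), S2β, crux 20520, 19936, 19200 and `YM3TorusSU2`
are NOT proved; no registered stub is closed; rung R3 = SU(2) YM₃ on T³ — NOT d = 4, NOT infinite volume, NOT a mass gap, NOT Clay; the Yang–Mills mass gap is NOT proved.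
-/

set_option autoImplicit false

noncomputable section

namespace Summit.QuantumFields.YangMills.Theorems.FluctuationComparisonRegPrIntLS2BetaStageDOfLetters

open Finset
open scoped Real
open Literature.MathematicalPhysics.QuantumLattice (su2Quat)
open Literature.MathematicalPhysics.QuantumFieldTheory.Balaban1983to89
open T4Continuum T3ContinuumYM3Torus T3UnitScaleTilt T3TiltDescent T3LevelShift BlockAveraging
open T4CubeChartGnomonic (SU2)
open T4HaarSU2ExpChart (expPoint)
open T4ExpWindowSmallField (logVec)
open T3UnitLawDensityEML (ℰp)
open T3ConstrainedMinimiser (fibre)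
open T3PrintedRegularMinimiser (minActionRegPr)
open T3PrintedMinimiserExistence (Thm1GlobalMinAt)
open T3Thm1UniquenessSchema (Thm1UniqueMinOrbitAt)
open B10Eq27TorusAxialLog (rel axialT)
open Summit.QuantumFields.YangMills.Theorems.FluctuationComparisonRegPrIntLS2BetaStageAxialFeedback (dStage_of_feedbackLetter)
open Summit.QuantumFields.YangMills.Theorems.FluctuationComparisonRegPrIntLS2BetaStageFeedersAssembly (feedbackLetterPrefix_of_letters)
open Summit.QuantumFields.YangMills.Theorems.FluctuationComparisonRegPrIntLS2BetaStageFlapLetterOfC4 (flapLetter_of_C4)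
open Summit.QuantumFields.YangMills.Theorems.FluctuationComparisonRegPrIntLS2BetaBackgroundTowerLetter (bkgTower_of_bkgLetter)
open Summit.QuantumFields.YangMills.Theorems.FluctuationComparisonRegPrIntLS2BetaBackgroundLetterOfThm1Pair (bkgLetter_of_thm1PairAtThree)

/-! ## §1 (D-stage)(Gx) from the BKG letter and KEYREL(Gx) — the composition of record, typed once -/

set_option maxHeartbeats 400000 in
/-- ★★★ **(D-stage)(Gx) FROM {BKG letter, KEYREL(Gx)}** for any guard `Gx ⟹ arc(V e) ≤ 1∕128`: ✓p824471 `dStage_of_feedbackLetter` ∘ ✓p827346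
`feedbackLetterPrefix_of_letters` ∘ ✓p827374 `flapLetter_of_C4` ∘ ✓p825096 `bkgTower_of_bkgLetter` — one term; `hKEY`, `hBkg` displayed; `C_D = 8·(exp E·C∕(L−1))²` with the
prefix assembly's `E, C`. [cite: Balaban1985Variational, Thm 1 (8)-(10) p.279, (4) p.278; Balaban1985RegularSpaces, (1.29) p.81, Lemma 1 p.79] -/
theorem dStage_of_bkgLetter_keyRel
    (Gx : (F : T3Family) → (J : ℕ) → GaugeField (F.P J) 0 (Matrix.specialUnitaryGroup (Fin 2) ℂ) → Prop)
    (hGx : ∀ (F : T3Family) (J : ℕ) (V : GaugeField (F.P J) 0 (Matrix.specialUnitaryGroup (Fin 2) ℂ)), Gx F J V →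
      ∀ e, ‖logVec (su2Quat (V e))‖ ≤ 1 / 128)
    (hBkg : ∀ (L : ℕ), ∃ c₀ : ℝ, 0 < c₀ ∧ c₀ ≤ 1 ∧ ∀ (cw : ℝ), 0 < cw → cw ≤ c₀ → ∃ pS : ℝ, ∀ (b₀ p₀ : ℝ), 0 < b₀ → pS ≤ p₀ → 0 < p₀ → ∃ ε₁ : ℝ, 0 < ε₁ ∧ ∀ (ε₀ : ℝ), 0 < ε₀ → ε₀ ≤ ε₁ →
    ∃ γ₁ : ℝ, 0 < γ₁ ∧ ∃ C₁ : ℝ, 0 ≤ C₁ ∧ ∀ (F : T3Family) (γ : ℝ), F.L = L → 0 < γ → γ ≤ γ₁ →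
      ∀ (J K : ℕ) (hJK : J ≤ K) (V : GaugeField (F.P J) 0 (Matrix.specialUnitaryGroup (Fin 2) ℂ)), PlaqSmall (θBal F.L γ (cw * b₀) p₀ J) V →
        Gx F J V →
        ∀ U₀ ∈ {U' : GaugeField (F.P K) 0 (Matrix.specialUnitaryGroup (Fin 2) ℂ) | U' ∈ fibre F ℰp J K hJK V ∧ U' ∈ histGood F ℰp (θBal F.L γ b₀ p₀) K J ∧
            wilsonAction4 U' = minActionRegPr F J K hJK ε₀ V},
        ∀ p : Plaq (F.P K) 0, dist1 (GaugeField.plaqHol U₀ p) ≤ C₁ * θBal F.L γ b₀ p₀ J * ((F.L : ℝ)⁻¹) ^ (2 * (K - J)))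
    (hKEY : ∀ (L : ℕ), ∃ c₀ : ℝ, 0 < c₀ ∧ c₀ ≤ 1 ∧ ∀ (cw : ℝ), 0 < cw → cw ≤ c₀ → ∃ pS : ℝ, ∀ (b₀ p₀ : ℝ), 0 < b₀ → pS ≤ p₀ → 0 < p₀ → ∃ ε₁ : ℝ, 0 < ε₁ ∧ ∀ (ε₀ : ℝ), 0 < ε₀ → ε₀ ≤ ε₁ →
      ∃ X₁ : ℝ, 1 ≤ X₁ ∧ ∀ (δ : ℝ), 0 < δ → ∃ γ₁ : ℝ, 0 < γ₁ ∧ ∀ (F : T3Family) (γ : ℝ), F.L = L → 0 < γ → γ ≤ γ₁ →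
        ∀ (J K : ℕ) (hJK : J ≤ K) (V : GaugeField (F.P J) 0 (Matrix.specialUnitaryGroup (Fin 2) ℂ)), PlaqSmall (θBal F.L γ (cw * b₀) p₀ J) V →
          Gx F J V →
          ∀ U₀ ∈ {U' : GaugeField (F.P K) 0 (Matrix.specialUnitaryGroup (Fin 2) ℂ) | U' ∈ fibre F ℰp J K hJK V ∧ U' ∈ histGood F ℰp (θBal F.L γ b₀ p₀) K J ∧
              wilsonAction4 U' = minActionRegPr F J K hJK ε₀ V},
          ∀ U ∈ fibre F ℰp J K hJK V, U ∈ histGood F ℰp (θBal F.L γ b₀ p₀) K J →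
          ∀ (wt : (j : ℕ) → PBond (F.P K) j → PBond (F.P K) (j + 1) → ℝ)
            (lift : (j : ℕ) → GaugeField (F.P K) (j + 1) SU2 → GaugeField (F.P K) j SU2),
            (∀ j b e, wt j b e = if e.dir = b.dir ∧ (b.src b.dir - emb e.src b.dir).val < (F.P K).L then
                ∏ ν ∈ Finset.univ.erase b.dir, max 0 (1 - ((rel (emb e.src) b.src ν).natAbs : ℝ) / (F.P K).L) else 0) →
            (∀ j X b, lift j X b = expPoint (∑ e, wt j b e • ((((F.P K).L : ℕ) : ℝ)⁻¹ • logVec (su2Quat (X e))))) →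
          ∀ g g₀ : (j : ℕ) → Site (F.P K) j → SU2,
            (∀ j, j < K - J → ∀ x, g j x =
              (axialT (lift j (GaugeField.gaugeAct (g (j + 1)) (Averaging.iter (fun k => blockAvg (P := F.P K) (j := k) ℰp) (j + 1) U)))
                  (emb (blockOf x)) x)⁻¹ *
                g (j + 1) (blockOf x) * axialT (Averaging.iter (fun k => blockAvg (P := F.P K) (j := k) ℰp) j U) (emb (blockOf x)) x) →
            (∀ j, K - J ≤ j → ∀ y, g j y = 1) →
            (∀ j, j < K - J → ∀ y : Site (F.P K) (j + 1), g j (emb y) = g (j + 1) y) →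
            (∀ X : GaugeField (F.P K) 0 SU2, ∀ j, j ≤ K - J →
              Averaging.iter (fun k => blockAvg (P := F.P K) (j := k) ℰp) j (GaugeField.gaugeAct (g 0) X) =
                GaugeField.gaugeAct (g j) (Averaging.iter (fun k => blockAvg (P := F.P K) (j := k) ℰp) j X)) →
            (∀ j, j < K - J → ∀ x,
              axialT (GaugeField.gaugeAct (g j) (Averaging.iter (fun k => blockAvg (P := F.P K) (j := k) ℰp) j U)) (emb (blockOf x)) x =
                axialT (lift j (GaugeField.gaugeAct (g (j + 1)) (Averaging.iter (fun k => blockAvg (P := F.P K) (j := k) ℰp) (j + 1) U)))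
                  (emb (blockOf x)) x) →
            (∀ j, j < K - J →
              (blockAvg (P := F.P K) (j := j) ℰp).avg (GaugeField.gaugeAct (g j) (Averaging.iter (fun k => blockAvg (P := F.P K) (j := k) ℰp) j U)) =
                GaugeField.gaugeAct (g (j + 1)) (Averaging.iter (fun k => blockAvg (P := F.P K) (j := k) ℰp) (j + 1) U)) →
            (∀ j, j < K - J → ∀ x, g₀ j x =
              (axialT (lift j (GaugeField.gaugeAct (g₀ (j + 1)) (Averaging.iter (fun k => blockAvg (P := F.P K) (j := k) ℰp) (j + 1) U₀)))
                  (emb (blockOf x)) x)⁻¹ *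
                g₀ (j + 1) (blockOf x) * axialT (Averaging.iter (fun k => blockAvg (P := F.P K) (j := k) ℰp) j U₀) (emb (blockOf x)) x) →
            (∀ j, K - J ≤ j → ∀ y, g₀ j y = 1) →
            (∀ j, j < K - J → ∀ y : Site (F.P K) (j + 1), g₀ j (emb y) = g₀ (j + 1) y) →
            (∀ X : GaugeField (F.P K) 0 SU2, ∀ j, j ≤ K - J →
              Averaging.iter (fun k => blockAvg (P := F.P K) (j := k) ℰp) j (GaugeField.gaugeAct (g₀ 0) X) =
                GaugeField.gaugeAct (g₀ j) (Averaging.iter (fun k => blockAvg (P := F.P K) (j := k) ℰp) j X)) →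
            (∀ j, j < K - J → ∀ x,
              axialT (GaugeField.gaugeAct (g₀ j) (Averaging.iter (fun k => blockAvg (P := F.P K) (j := k) ℰp) j U₀)) (emb (blockOf x)) x =
                axialT (lift j (GaugeField.gaugeAct (g₀ (j + 1)) (Averaging.iter (fun k => blockAvg (P := F.P K) (j := k) ℰp) (j + 1) U₀)))
                  (emb (blockOf x)) x) →
            (∀ j, j < K - J →
              (blockAvg (P := F.P K) (j := j) ℰp).avg (GaugeField.gaugeAct (g₀ j) (Averaging.iter (fun k => blockAvg (P := F.P K) (j := k) ℰp) j U₀)) =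
                GaugeField.gaugeAct (g₀ (j + 1)) (Averaging.iter (fun k => blockAvg (P := F.P K) (j := k) ℰp) (j + 1) U₀)) →
            ∃ (ηA qd qU : ℕ → ℝ), (∀ s, 0 ≤ qd s) ∧ (∀ s, 0 ≤ qU s) ∧
              (∀ t, t ≤ K - J →
                √(∑ q, dist1 ((GaugeField.plaqHol (GaugeField.gaugeAct (g₀ t) (Averaging.iter (fun k => blockAvg (P := F.P K) (j := k) ℰp) t U₀)) q)⁻¹ *
                  GaugeField.plaqHol (GaugeField.gaugeAct (g t) (Averaging.iter (fun k => blockAvg (P := F.P K) (j := k) ℰp) t U)) q) ^ 2) ≤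
                  X₁ * (Real.sqrt (F.L : ℝ) ^ t * √(∑ p, dist1 ((GaugeField.plaqHol (GaugeField.gaugeAct (g₀ 0) U₀) p)⁻¹ * GaugeField.plaqHol (GaugeField.gaugeAct (g 0) U) p) ^ 2) +
                    ∑ s ∈ range t, Real.sqrt (F.L : ℝ) ^ (t - 1 - s) * ηA s)) ∧
              (∀ s, s < K - J → ηA s ≤ qd s * √(∑ b, dist1 (GaugeField.gaugeAct (g s) (Averaging.iter (fun k => blockAvg (P := F.P K) (j := k) ℰp) s U) b *
                  (GaugeField.gaugeAct (g₀ s) (Averaging.iter (fun k => blockAvg (P := F.P K) (j := k) ℰp) s U₀) b)⁻¹) ^ 2) +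
                qU s * √(∑ b, dist1 (GaugeField.gaugeAct (g (s + 1)) (Averaging.iter (fun k => blockAvg (P := F.P K) (j := k) ℰp) (s + 1) U) b *
                  (GaugeField.gaugeAct (g₀ (s + 1)) (Averaging.iter (fun k => blockAvg (P := F.P K) (j := k) ℰp) (s + 1) U₀) b)⁻¹) ^ 2)) ∧
              ∑ j ∈ range (K - J), ∑ u ∈ range (j + 1), (F.L : ℝ) ^ (j - u) * qd u ≤ δ ∧
              ∑ j ∈ range (K - J), ∑ u ∈ range (j + 1), (F.L : ℝ) ^ (j - u) * qU u ≤ δ)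
    : ∀ (L : ℕ), ∃ c₀ : ℝ, 0 < c₀ ∧ c₀ ≤ 1 ∧ ∀ (cw : ℝ), 0 < cw → cw ≤ c₀ → ∃ pS : ℝ, ∀ (b₀ p₀ : ℝ), 0 < b₀ → pS ≤ p₀ → 0 < p₀ → ∃ ε₁ : ℝ, 0 < ε₁ ∧ ∀ (ε₀ : ℝ), 0 < ε₀ → ε₀ ≤ ε₁ →
    ∃ γ₁ : ℝ, 0 < γ₁ ∧ ∃ C_D : ℝ, 0 < C_D ∧ ∀ (F : T3Family) (γ : ℝ), F.L = L → 0 < γ → γ ≤ γ₁ →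
      ∀ (J K : ℕ) (hJK : J ≤ K) (V : GaugeField (F.P J) 0 (Matrix.specialUnitaryGroup (Fin 2) ℂ)), PlaqSmall (θBal F.L γ (cw * b₀) p₀ J) V →
        Gx F J V →
        ∀ U₀ ∈ {U' : GaugeField (F.P K) 0 (Matrix.specialUnitaryGroup (Fin 2) ℂ) | U' ∈ fibre F ℰp J K hJK V ∧ U' ∈ histGood F ℰp (θBal F.L γ b₀ p₀) K J ∧
            wilsonAction4 U' = minActionRegPr F J K hJK ε₀ V},
        ∀ U ∈ fibre F ℰp J K hJK V, U ∈ histGood F ℰp (θBal F.L γ b₀ p₀) K J →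
        (          ∃ (wt : (j : ℕ) → PBond (F.P K) j → PBond (F.P K) (j + 1) → ℝ)
            (lift : (j : ℕ) → GaugeField (F.P K) (j + 1) SU2 → GaugeField (F.P K) j SU2)
            (U₁ : GaugeField (F.P K) 0 SU2) (g g₀ : (j : ℕ) → Site (F.P K) j → SU2),
          (∀ j b e, wt j b e = if e.dir = b.dir ∧ (b.src b.dir - emb e.src b.dir).val < (F.P K).L then
              ∏ ν ∈ Finset.univ.erase b.dir, max 0 (1 - ((rel (emb e.src) b.src ν).natAbs : ℝ) / (F.P K).L) else 0) ∧
          (∀ j X b, lift j X b = expPoint (∑ e, wt j b e • ((((F.P K).L : ℕ) : ℝ)⁻¹ • logVec (su2Quat (X e))))) ∧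
          (∀ j, j < K - J → ∀ x, g j x =
            (axialT (lift j (GaugeField.gaugeAct (g (j + 1)) (Averaging.iter (fun k => blockAvg (P := F.P K) (j := k) ℰp) (j + 1) U)))
                (emb (blockOf x)) x)⁻¹ *
              g (j + 1) (blockOf x) * axialT (Averaging.iter (fun k => blockAvg (P := F.P K) (j := k) ℰp) j U) (emb (blockOf x)) x) ∧
          (∀ j, K - J ≤ j → ∀ y, g j y = 1) ∧
          (∀ j, j < K - J → ∀ y : Site (F.P K) (j + 1), g j (emb y) = g (j + 1) y) ∧
          (∀ X : GaugeField (F.P K) 0 SU2, ∀ j, j ≤ K - J →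
            Averaging.iter (fun k => blockAvg (P := F.P K) (j := k) ℰp) j (GaugeField.gaugeAct (g 0) X) =
              GaugeField.gaugeAct (g j) (Averaging.iter (fun k => blockAvg (P := F.P K) (j := k) ℰp) j X)) ∧
          (∀ j, j < K - J → ∀ x,
            axialT (GaugeField.gaugeAct (g j) (Averaging.iter (fun k => blockAvg (P := F.P K) (j := k) ℰp) j U)) (emb (blockOf x)) x =
              axialT (lift j (GaugeField.gaugeAct (g (j + 1)) (Averaging.iter (fun k => blockAvg (P := F.P K) (j := k) ℰp) (j + 1) U)))
                (emb (blockOf x)) x) ∧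
          (∀ j, j < K - J →
            (blockAvg (P := F.P K) (j := j) ℰp).avg (GaugeField.gaugeAct (g j) (Averaging.iter (fun k => blockAvg (P := F.P K) (j := k) ℰp) j U)) =
              GaugeField.gaugeAct (g (j + 1)) (Averaging.iter (fun k => blockAvg (P := F.P K) (j := k) ℰp) (j + 1) U)) ∧
          (∀ j, j < K - J → ∀ x, g₀ j x =
            (axialT (lift j (GaugeField.gaugeAct (g₀ (j + 1)) (Averaging.iter (fun k => blockAvg (P := F.P K) (j := k) ℰp) (j + 1) U₁)))
                (emb (blockOf x)) x)⁻¹ *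
              g₀ (j + 1) (blockOf x) * axialT (Averaging.iter (fun k => blockAvg (P := F.P K) (j := k) ℰp) j U₁) (emb (blockOf x)) x) ∧
          (∀ j, K - J ≤ j → ∀ y, g₀ j y = 1) ∧
          (∀ j, j < K - J → ∀ y : Site (F.P K) (j + 1), g₀ j (emb y) = g₀ (j + 1) y) ∧
          (∀ X : GaugeField (F.P K) 0 SU2, ∀ j, j ≤ K - J →
            Averaging.iter (fun k => blockAvg (P := F.P K) (j := k) ℰp) j (GaugeField.gaugeAct (g₀ 0) X) =
              GaugeField.gaugeAct (g₀ j) (Averaging.iter (fun k => blockAvg (P := F.P K) (j := k) ℰp) j X)) ∧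
          (∀ j, j < K - J → ∀ x,
            axialT (GaugeField.gaugeAct (g₀ j) (Averaging.iter (fun k => blockAvg (P := F.P K) (j := k) ℰp) j U₁)) (emb (blockOf x)) x =
              axialT (lift j (GaugeField.gaugeAct (g₀ (j + 1)) (Averaging.iter (fun k => blockAvg (P := F.P K) (j := k) ℰp) (j + 1) U₁)))
                (emb (blockOf x)) x) ∧
          (∀ j, j < K - J →
            (blockAvg (P := F.P K) (j := j) ℰp).avg (GaugeField.gaugeAct (g₀ j) (Averaging.iter (fun k => blockAvg (P := F.P K) (j := k) ℰp) j U₁)) =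
              GaugeField.gaugeAct (g₀ (j + 1)) (Averaging.iter (fun k => blockAvg (P := F.P K) (j := k) ℰp) (j + 1) U₁)) ∧
          (∀ X : GaugeField (F.P K) 0 SU2, Averaging.iter (fun k => blockAvg (P := F.P K) (j := k) ℰp) (K - J) (GaugeField.gaugeAct (fun x => (g 0 x)⁻¹) X) = Averaging.iter (fun k => blockAvg (P := F.P K) (j := k) ℰp) (K - J) X) ∧
          (∀ X : GaugeField (F.P K) 0 SU2, Averaging.iter (fun k => blockAvg (P := F.P K) (j := k) ℰp) (K - J) (GaugeField.gaugeAct (g₀ 0) X) = Averaging.iter (fun k => blockAvg (P := F.P K) (j := k) ℰp) (K - J) X) ∧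
          U₀ = GaugeField.gaugeAct (fun x => (g 0 x)⁻¹ * g₀ 0 x) U₁) →
        ((F.L : ℝ)⁻¹) ^ (2 * (K - J)) * ∑ ℓ : PBond (F.P K) 0, dist1 (U ℓ * (U₀ ℓ)⁻¹) ^ 2
          ≤ C_D * ∑ p : Plaq (F.P K) 0, (1 - reTr ((GaugeField.plaqHol U₀ p)⁻¹ * GaugeField.plaqHol U p)) :=
  dStage_of_feedbackLetter Gx
    (feedbackLetterPrefix_of_letters Gx hGx hKEY (flapLetter_of_C4 Gx hGx (bkgTower_of_bkgLetter Gx hBkg)))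

/-! ## §2 (D-stage)(Gx) from the `L = 3` Thm-1 pair and KEYREL(Gx) only (the BKG letter discharged by ✓p822405) -/

set_option maxHeartbeats 400000 in
/-- ★★★ **(D-stage)(Gx) FROM {the `L = 3` Thm-1 pair, KEYREL(Gx)}** — §1 with `hBkg := bkgLetter_of_thm1PairAtThree h3 Gx` (✓p822405): once px10 g24's DOOR
`keyRel_of_bkgTower` lands, the (D)-side under the small-bond guard rests on `h3` alone. [cite: Balaban1985Variational, Thm 1 (8)-(10) p.279, (4) p.278] -/
theorem dStage_of_three_keyRel
    (Gx : (F : T3Family) → (J : ℕ) → GaugeField (F.P J) 0 (Matrix.specialUnitaryGroup (Fin 2) ℂ) → Prop)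
    (hGx : ∀ (F : T3Family) (J : ℕ) (V : GaugeField (F.P J) 0 (Matrix.specialUnitaryGroup (Fin 2) ℂ)), Gx F J V →
      ∀ e, ‖logVec (su2Quat (V e))‖ ≤ 1 / 128)
    (h3 : ∃ a₀ a₁ B₃ : ℝ, 0 < a₀ ∧ 0 < a₁ ∧ 0 < B₃ ∧ Thm1GlobalMinAt 3 a₀ a₁ B₃ ∧ Thm1UniqueMinOrbitAt 3 a₀ a₁ B₃)
    (hKEY : ∀ (L : ℕ), ∃ c₀ : ℝ, 0 < c₀ ∧ c₀ ≤ 1 ∧ ∀ (cw : ℝ), 0 < cw → cw ≤ c₀ → ∃ pS : ℝ, ∀ (b₀ p₀ : ℝ), 0 < b₀ → pS ≤ p₀ → 0 < p₀ → ∃ ε₁ : ℝ, 0 < ε₁ ∧ ∀ (ε₀ : ℝ), 0 < ε₀ → ε₀ ≤ ε₁ →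
      ∃ X₁ : ℝ, 1 ≤ X₁ ∧ ∀ (δ : ℝ), 0 < δ → ∃ γ₁ : ℝ, 0 < γ₁ ∧ ∀ (F : T3Family) (γ : ℝ), F.L = L → 0 < γ → γ ≤ γ₁ →
        ∀ (J K : ℕ) (hJK : J ≤ K) (V : GaugeField (F.P J) 0 (Matrix.specialUnitaryGroup (Fin 2) ℂ)), PlaqSmall (θBal F.L γ (cw * b₀) p₀ J) V →
          Gx F J V →
          ∀ U₀ ∈ {U' : GaugeField (F.P K) 0 (Matrix.specialUnitaryGroup (Fin 2) ℂ) | U' ∈ fibre F ℰp J K hJK V ∧ U' ∈ histGood F ℰp (θBal F.L γ b₀ p₀) K J ∧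
              wilsonAction4 U' = minActionRegPr F J K hJK ε₀ V},
          ∀ U ∈ fibre F ℰp J K hJK V, U ∈ histGood F ℰp (θBal F.L γ b₀ p₀) K J →
          ∀ (wt : (j : ℕ) → PBond (F.P K) j → PBond (F.P K) (j + 1) → ℝ)
            (lift : (j : ℕ) → GaugeField (F.P K) (j + 1) SU2 → GaugeField (F.P K) j SU2),
            (∀ j b e, wt j b e = if e.dir = b.dir ∧ (b.src b.dir - emb e.src b.dir).val < (F.P K).L then
                ∏ ν ∈ Finset.univ.erase b.dir, max 0 (1 - ((rel (emb e.src) b.src ν).natAbs : ℝ) / (F.P K).L) else 0) →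
            (∀ j X b, lift j X b = expPoint (∑ e, wt j b e • ((((F.P K).L : ℕ) : ℝ)⁻¹ • logVec (su2Quat (X e))))) →
          ∀ g g₀ : (j : ℕ) → Site (F.P K) j → SU2,
            (∀ j, j < K - J → ∀ x, g j x =
              (axialT (lift j (GaugeField.gaugeAct (g (j + 1)) (Averaging.iter (fun k => blockAvg (P := F.P K) (j := k) ℰp) (j + 1) U)))
                  (emb (blockOf x)) x)⁻¹ *
                g (j + 1) (blockOf x) * axialT (Averaging.iter (fun k => blockAvg (P := F.P K) (j := k) ℰp) j U) (emb (blockOf x)) x) →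
            (∀ j, K - J ≤ j → ∀ y, g j y = 1) →
            (∀ j, j < K - J → ∀ y : Site (F.P K) (j + 1), g j (emb y) = g (j + 1) y) →
            (∀ X : GaugeField (F.P K) 0 SU2, ∀ j, j ≤ K - J →
              Averaging.iter (fun k => blockAvg (P := F.P K) (j := k) ℰp) j (GaugeField.gaugeAct (g 0) X) =
                GaugeField.gaugeAct (g j) (Averaging.iter (fun k => blockAvg (P := F.P K) (j := k) ℰp) j X)) →
            (∀ j, j < K - J → ∀ x,
              axialT (GaugeField.gaugeAct (g j) (Averaging.iter (fun k => blockAvg (P := F.P K) (j := k) ℰp) j U)) (emb (blockOf x)) x =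
                axialT (lift j (GaugeField.gaugeAct (g (j + 1)) (Averaging.iter (fun k => blockAvg (P := F.P K) (j := k) ℰp) (j + 1) U)))
                  (emb (blockOf x)) x) →
            (∀ j, j < K - J →
              (blockAvg (P := F.P K) (j := j) ℰp).avg (GaugeField.gaugeAct (g j) (Averaging.iter (fun k => blockAvg (P := F.P K) (j := k) ℰp) j U)) =
                GaugeField.gaugeAct (g (j + 1)) (Averaging.iter (fun k => blockAvg (P := F.P K) (j := k) ℰp) (j + 1) U)) →
            (∀ j, j < K - J → ∀ x, g₀ j x =
              (axialT (lift j (GaugeField.gaugeAct (g₀ (j + 1)) (Averaging.iter (fun k => blockAvg (P := F.P K) (j := k) ℰp) (j + 1) U₀)))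
                  (emb (blockOf x)) x)⁻¹ *
                g₀ (j + 1) (blockOf x) * axialT (Averaging.iter (fun k => blockAvg (P := F.P K) (j := k) ℰp) j U₀) (emb (blockOf x)) x) →
            (∀ j, K - J ≤ j → ∀ y, g₀ j y = 1) →
            (∀ j, j < K - J → ∀ y : Site (F.P K) (j + 1), g₀ j (emb y) = g₀ (j + 1) y) →
            (∀ X : GaugeField (F.P K) 0 SU2, ∀ j, j ≤ K - J →
              Averaging.iter (fun k => blockAvg (P := F.P K) (j := k) ℰp) j (GaugeField.gaugeAct (g₀ 0) X) =
                GaugeField.gaugeAct (g₀ j) (Averaging.iter (fun k => blockAvg (P := F.P K) (j := k) ℰp) j X)) →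
            (∀ j, j < K - J → ∀ x,
              axialT (GaugeField.gaugeAct (g₀ j) (Averaging.iter (fun k => blockAvg (P := F.P K) (j := k) ℰp) j U₀)) (emb (blockOf x)) x =
                axialT (lift j (GaugeField.gaugeAct (g₀ (j + 1)) (Averaging.iter (fun k => blockAvg (P := F.P K) (j := k) ℰp) (j + 1) U₀)))
                  (emb (blockOf x)) x) →
            (∀ j, j < K - J →
              (blockAvg (P := F.P K) (j := j) ℰp).avg (GaugeField.gaugeAct (g₀ j) (Averaging.iter (fun k => blockAvg (P := F.P K) (j := k) ℰp) j U₀)) =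
                GaugeField.gaugeAct (g₀ (j + 1)) (Averaging.iter (fun k => blockAvg (P := F.P K) (j := k) ℰp) (j + 1) U₀)) →
            ∃ (ηA qd qU : ℕ → ℝ), (∀ s, 0 ≤ qd s) ∧ (∀ s, 0 ≤ qU s) ∧
              (∀ t, t ≤ K - J →
                √(∑ q, dist1 ((GaugeField.plaqHol (GaugeField.gaugeAct (g₀ t) (Averaging.iter (fun k => blockAvg (P := F.P K) (j := k) ℰp) t U₀)) q)⁻¹ *
                  GaugeField.plaqHol (GaugeField.gaugeAct (g t) (Averaging.iter (fun k => blockAvg (P := F.P K) (j := k) ℰp) t U)) q) ^ 2) ≤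
                  X₁ * (Real.sqrt (F.L : ℝ) ^ t * √(∑ p, dist1 ((GaugeField.plaqHol (GaugeField.gaugeAct (g₀ 0) U₀) p)⁻¹ * GaugeField.plaqHol (GaugeField.gaugeAct (g 0) U) p) ^ 2) +
                    ∑ s ∈ range t, Real.sqrt (F.L : ℝ) ^ (t - 1 - s) * ηA s)) ∧
              (∀ s, s < K - J → ηA s ≤ qd s * √(∑ b, dist1 (GaugeField.gaugeAct (g s) (Averaging.iter (fun k => blockAvg (P := F.P K) (j := k) ℰp) s U) b *
                  (GaugeField.gaugeAct (g₀ s) (Averaging.iter (fun k => blockAvg (P := F.P K) (j := k) ℰp) s U₀) b)⁻¹) ^ 2) +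
                qU s * √(∑ b, dist1 (GaugeField.gaugeAct (g (s + 1)) (Averaging.iter (fun k => blockAvg (P := F.P K) (j := k) ℰp) (s + 1) U) b *
                  (GaugeField.gaugeAct (g₀ (s + 1)) (Averaging.iter (fun k => blockAvg (P := F.P K) (j := k) ℰp) (s + 1) U₀) b)⁻¹) ^ 2)) ∧
              ∑ j ∈ range (K - J), ∑ u ∈ range (j + 1), (F.L : ℝ) ^ (j - u) * qd u ≤ δ ∧
              ∑ j ∈ range (K - J), ∑ u ∈ range (j + 1), (F.L : ℝ) ^ (j - u) * qU u ≤ δ)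
    : ∀ (L : ℕ), ∃ c₀ : ℝ, 0 < c₀ ∧ c₀ ≤ 1 ∧ ∀ (cw : ℝ), 0 < cw → cw ≤ c₀ → ∃ pS : ℝ, ∀ (b₀ p₀ : ℝ), 0 < b₀ → pS ≤ p₀ → 0 < p₀ → ∃ ε₁ : ℝ, 0 < ε₁ ∧ ∀ (ε₀ : ℝ), 0 < ε₀ → ε₀ ≤ ε₁ →
    ∃ γ₁ : ℝ, 0 < γ₁ ∧ ∃ C_D : ℝ, 0 < C_D ∧ ∀ (F : T3Family) (γ : ℝ), F.L = L → 0 < γ → γ ≤ γ₁ →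
      ∀ (J K : ℕ) (hJK : J ≤ K) (V : GaugeField (F.P J) 0 (Matrix.specialUnitaryGroup (Fin 2) ℂ)), PlaqSmall (θBal F.L γ (cw * b₀) p₀ J) V →
        Gx F J V →
        ∀ U₀ ∈ {U' : GaugeField (F.P K) 0 (Matrix.specialUnitaryGroup (Fin 2) ℂ) | U' ∈ fibre F ℰp J K hJK V ∧ U' ∈ histGood F ℰp (θBal F.L γ b₀ p₀) K J ∧
            wilsonAction4 U' = minActionRegPr F J K hJK ε₀ V},
        ∀ U ∈ fibre F ℰp J K hJK V, U ∈ histGood F ℰp (θBal F.L γ b₀ p₀) K J →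
        (          ∃ (wt : (j : ℕ) → PBond (F.P K) j → PBond (F.P K) (j + 1) → ℝ)
            (lift : (j : ℕ) → GaugeField (F.P K) (j + 1) SU2 → GaugeField (F.P K) j SU2)
            (U₁ : GaugeField (F.P K) 0 SU2) (g g₀ : (j : ℕ) → Site (F.P K) j → SU2),
          (∀ j b e, wt j b e = if e.dir = b.dir ∧ (b.src b.dir - emb e.src b.dir).val < (F.P K).L then
              ∏ ν ∈ Finset.univ.erase b.dir, max 0 (1 - ((rel (emb e.src) b.src ν).natAbs : ℝ) / (F.P K).L) else 0) ∧
          (∀ j X b, lift j X b = expPoint (∑ e, wt j b e • ((((F.P K).L : ℕ) : ℝ)⁻¹ • logVec (su2Quat (X e))))) ∧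
          (∀ j, j < K - J → ∀ x, g j x =
            (axialT (lift j (GaugeField.gaugeAct (g (j + 1)) (Averaging.iter (fun k => blockAvg (P := F.P K) (j := k) ℰp) (j + 1) U)))
                (emb (blockOf x)) x)⁻¹ *
              g (j + 1) (blockOf x) * axialT (Averaging.iter (fun k => blockAvg (P := F.P K) (j := k) ℰp) j U) (emb (blockOf x)) x) ∧
          (∀ j, K - J ≤ j → ∀ y, g j y = 1) ∧
          (∀ j, j < K - J → ∀ y : Site (F.P K) (j + 1), g j (emb y) = g (j + 1) y) ∧
          (∀ X : GaugeField (F.P K) 0 SU2, ∀ j, j ≤ K - J →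
            Averaging.iter (fun k => blockAvg (P := F.P K) (j := k) ℰp) j (GaugeField.gaugeAct (g 0) X) =
              GaugeField.gaugeAct (g j) (Averaging.iter (fun k => blockAvg (P := F.P K) (j := k) ℰp) j X)) ∧
          (∀ j, j < K - J → ∀ x,
            axialT (GaugeField.gaugeAct (g j) (Averaging.iter (fun k => blockAvg (P := F.P K) (j := k) ℰp) j U)) (emb (blockOf x)) x =
              axialT (lift j (GaugeField.gaugeAct (g (j + 1)) (Averaging.iter (fun k => blockAvg (P := F.P K) (j := k) ℰp) (j + 1) U)))
                (emb (blockOf x)) x) ∧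
          (∀ j, j < K - J →
            (blockAvg (P := F.P K) (j := j) ℰp).avg (GaugeField.gaugeAct (g j) (Averaging.iter (fun k => blockAvg (P := F.P K) (j := k) ℰp) j U)) =
              GaugeField.gaugeAct (g (j + 1)) (Averaging.iter (fun k => blockAvg (P := F.P K) (j := k) ℰp) (j + 1) U)) ∧
          (∀ j, j < K - J → ∀ x, g₀ j x =
            (axialT (lift j (GaugeField.gaugeAct (g₀ (j + 1)) (Averaging.iter (fun k => blockAvg (P := F.P K) (j := k) ℰp) (j + 1) U₁)))
                (emb (blockOf x)) x)⁻¹ *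
              g₀ (j + 1) (blockOf x) * axialT (Averaging.iter (fun k => blockAvg (P := F.P K) (j := k) ℰp) j U₁) (emb (blockOf x)) x) ∧
          (∀ j, K - J ≤ j → ∀ y, g₀ j y = 1) ∧
          (∀ j, j < K - J → ∀ y : Site (F.P K) (j + 1), g₀ j (emb y) = g₀ (j + 1) y) ∧
          (∀ X : GaugeField (F.P K) 0 SU2, ∀ j, j ≤ K - J →
            Averaging.iter (fun k => blockAvg (P := F.P K) (j := k) ℰp) j (GaugeField.gaugeAct (g₀ 0) X) =
              GaugeField.gaugeAct (g₀ j) (Averaging.iter (fun k => blockAvg (P := F.P K) (j := k) ℰp) j X)) ∧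
          (∀ j, j < K - J → ∀ x,
            axialT (GaugeField.gaugeAct (g₀ j) (Averaging.iter (fun k => blockAvg (P := F.P K) (j := k) ℰp) j U₁)) (emb (blockOf x)) x =
              axialT (lift j (GaugeField.gaugeAct (g₀ (j + 1)) (Averaging.iter (fun k => blockAvg (P := F.P K) (j := k) ℰp) (j + 1) U₁)))
                (emb (blockOf x)) x) ∧
          (∀ j, j < K - J →
            (blockAvg (P := F.P K) (j := j) ℰp).avg (GaugeField.gaugeAct (g₀ j) (Averaging.iter (fun k => blockAvg (P := F.P K) (j := k) ℰp) j U₁)) =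
              GaugeField.gaugeAct (g₀ (j + 1)) (Averaging.iter (fun k => blockAvg (P := F.P K) (j := k) ℰp) (j + 1) U₁)) ∧
          (∀ X : GaugeField (F.P K) 0 SU2, Averaging.iter (fun k => blockAvg (P := F.P K) (j := k) ℰp) (K - J) (GaugeField.gaugeAct (fun x => (g 0 x)⁻¹) X) = Averaging.iter (fun k => blockAvg (P := F.P K) (j := k) ℰp) (K - J) X) ∧
          (∀ X : GaugeField (F.P K) 0 SU2, Averaging.iter (fun k => blockAvg (P := F.P K) (j := k) ℰp) (K - J) (GaugeField.gaugeAct (g₀ 0) X) = Averaging.iter (fun k => blockAvg (P := F.P K) (j := k) ℰp) (K - J) X) ∧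
          U₀ = GaugeField.gaugeAct (fun x => (g 0 x)⁻¹ * g₀ 0 x) U₁) →
        ((F.L : ℝ)⁻¹) ^ (2 * (K - J)) * ∑ ℓ : PBond (F.P K) 0, dist1 (U ℓ * (U₀ ℓ)⁻¹) ^ 2
          ≤ C_D * ∑ p : Plaq (F.P K) 0, (1 - reTr ((GaugeField.plaqHol U₀ p)⁻¹ * GaugeField.plaqHol U p)) :=
  dStage_of_bkgLetter_keyRel Gx hGx (bkgLetter_of_thm1PairAtThree h3 Gx) hKEY

end Summit.QuantumFields.YangMills.Theorems.FluctuationComparisonRegPrIntLS2BetaStageDOfLetters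

end
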